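import Mathlib.Analysis.Complex.ExponentialBounds
import Mathlib.Analysis.Real.Pi.Bounds
import Mathlib.Analysis.SpecialFunctions.Log.Basic
import HarnessLib

/-!
# Javanpeykar 2014, §2.4: Lemma 2.4.3 and the constant `10 g³` of Prop. 2.4.8

Topic `NumberTheory/DiophantineGeometry`; companion of `BelyiDegreeFaltingsHeight.lean`,
`BelyiCoverMerklAtlasConstants.lean`, `BelyiHeightBoundConstants.lean` (A. Javanpeykar,
*Polynomial bounds for Arakelov invariants of Belyi curves*, Algebra & Number Theory **8** (2014),
arXiv:1403.6404). §2.4 bounds the Arakelov invariants `h_Fal, e, Δ, δ_Fal` of a curve in the height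
of a non-Weierstrass point (Thm. 2.4.1); besides the Arakelov-theoretic inputs (Lemmas 2.4.2,
2.4.4–2.4.7: Bost, de Jong, Noether's formula — not available) the section contains two elementary
statements, proved here:

* **`lemma243`** — Lemma 2.4.3: for `a > 0` and every real `x ≥ b`,
  `x - a log max(1, x) ≥ x/2 + min(b/2, a - a log(2a))` (used in Lemma 2.4.5 with `x = h_Fal(X)`,
  `a = g/4`, `b = -g log(2π)`); the printed hypothesis `b ≤ 1` turns out to be unnecessary, and
  the printed case distinction `2a ≤ 1` / `2a > 1` is replaced by `log t ≤ t - 1`;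
* **`prop248_constant`** — the inequality "it is straightforward to verify" closing the proof of
  Prop. 2.4.8: `(4g³ + 5g + 1) log 2 + max((g/2) log(2π), (g/4) log(g/2) - g/4) ≤ 10 g³` for every
  integer `g ≥ 1` (the paper needs `g ≥ 2`; with `log 2 ≤ 0.6932`, `log(2π) ≤ 1.84`,
  `log(g/2) ≤ g/2 - 1` the left side is `≤ 7.86 g³`).

Theorems only; no definition, no named fact. These serve the `δ_Fal`/`Δ`/`e` rows of Thm. 1.1.1,
not the `h_Fal` row vendored as `javanpeykar2014_stableFaltingsHeight_le`.

## References

* A. Javanpeykar, *Polynomial bounds for Arakelov invariants of Belyi curves* (appendix by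
  P. Bruin), Algebra & Number Theory 8 (2014), no. 1, 89–140, doi:10.2140/ant.2014.8.89,
  arXiv:1403.6404: Lemma 2.4.3, Lemma 2.4.5, Prop. 2.4.8. [Javanpeykar2014]
-/

noncomputable section

open Real

namespace Literature.NumberTheory.DiophantineGeometry

namespace Javanpeykar2014

/-! ### Lemma 2.4.3 -/

/-- `x - 2a log x ≥ 2a - 2a log(2a)` for `x, a > 0` (the minimum of `x - 2a log x` is at `x = 2a`;
from `log t ≤ t - 1` at `t = x/(2a)`). [cite: Javanpeykar2014, Lemma 2.4.3 (proof)] -/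
theorem sub_mul_log_ge {a x : ℝ} (ha : 0 < a) (hx : 0 < x) :
    2 * a - 2 * a * Real.log (2 * a) ≤ x - 2 * a * Real.log x := by
  have h2a : 0 < 2 * a := by linarith
  have h := Real.log_le_sub_one_of_pos (div_pos hx h2a)
  rw [Real.log_div hx.ne' h2a.ne'] at h
  have h' := mul_le_mul_of_nonneg_left h h2a.le
  have e : 2 * a * (x / (2 * a) - 1) = x - 2 * a := by field_simp
  rw [e] at h'
  linarith

/-- **Javanpeykar 2014, Lemma 2.4.3.** Let `a > 0` (and `b ≤ 1` in the paper — this hypothesis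
is not needed). Then for all real `x ≥ b`,
`x - a log max(1, x) = x/2 + (x - 2a log max(1, x))/2 ≥ x/2 + min(b/2, a - a log(2a))`.
[cite: Javanpeykar2014, Lemma 2.4.3] -/
theorem lemma243 {a b x : ℝ} (ha : 0 < a) (hx : b ≤ x) :
    x / 2 + min (b / 2) (a - a * Real.log (2 * a)) ≤ x - a * Real.log (max 1 x) := by
  -- "It suffices to prove that `x - 2a log max(1,x) ≥ min(b, 2a - 2a log(2a))` for all `x ≥ b`."
  suffices h : min b (2 * a - 2 * a * Real.log (2 * a)) ≤ x - 2 * a * Real.log (max 1 x) by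
    have hmin : min (b / 2) (a - a * Real.log (2 * a)) =
        min b (2 * a - 2 * a * Real.log (2 * a)) / 2 := by
      rw [show a - a * Real.log (2 * a) = (2 * a - 2 * a * Real.log (2 * a)) / 2 by ring,
        ← min_div_div_right (by norm_num : (0 : ℝ) ≤ 2)]
    rw [hmin]
    linarith
  rcases le_or_gt x 1 with hx1 | hx1
  · -- `x ≤ 1`: `log max(1,x) = 0`
    rw [max_eq_left hx1, Real.log_one, mul_zero, sub_zero]
    exact (min_le_left _ _).trans hx
  · rw [max_eq_right hx1.le]
    exact (min_le_right _ _).trans (sub_mul_log_ge ha (by linarith))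

/-! ### The constant `10 g³` of Prop. 2.4.8 -/

/-- **The inequality closing the proof of Prop. 2.4.8** ("it is straightforward to verify"):
`(4g³ + 5g + 1) log 2 + max((g/2) log(2π), (g/4) log(g/2) - g/4) ≤ 10 g³` for every integer
`g ≥ 1`. [cite: Javanpeykar2014, Prop. 2.4.8 (proof)] -/
theorem prop248_constant {g : ℕ} (hg : 1 ≤ g) :
    (4 * (g : ℝ) ^ 3 + 5 * g + 1) * Real.log 2 +
        max ((g : ℝ) / 2 * Real.log (2 * π)) ((g : ℝ) / 4 * Real.log (g / 2) - g / 4) ≤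
      10 * (g : ℝ) ^ 3 := by
  have hg' : (1 : ℝ) ≤ g := by exact_mod_cast hg
  have hg0 : (0 : ℝ) < g := by linarith
  have hg3 : (g : ℝ) ≤ (g : ℝ) ^ 3 := le_self_pow₀ hg' (by norm_num)
  have hg13 : (1 : ℝ) ≤ (g : ℝ) ^ 3 := one_le_pow₀ hg'
  have hg23 : (g : ℝ) ^ 2 ≤ (g : ℝ) ^ 3 := pow_le_pow_right₀ hg' (by norm_num)
  have hlog2 : Real.log 2 ≤ 0.6932 := Real.log_two_lt_d9.le.trans (by norm_num)
  have hlog2' : 0 ≤ Real.log 2 := Real.log_nonneg (by norm_num)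
  -- first summand `≤ 6.932 g³`
  have h1 : (4 * (g : ℝ) ^ 3 + 5 * g + 1) * Real.log 2 ≤ 6.932 * (g : ℝ) ^ 3 := by
    have : 4 * (g : ℝ) ^ 3 + 5 * g + 1 ≤ 10 * (g : ℝ) ^ 3 := by linarith
    calc (4 * (g : ℝ) ^ 3 + 5 * g + 1) * Real.log 2 ≤ 10 * (g : ℝ) ^ 3 * 0.6932 :=
          mul_le_mul this hlog2 hlog2' (by positivity)
      _ = 6.932 * (g : ℝ) ^ 3 := by ring
  -- the maximum `≤ g³`
  have h2 : max ((g : ℝ) / 2 * Real.log (2 * π)) ((g : ℝ) / 4 * Real.log (g / 2) - g / 4) ≤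
      (g : ℝ) ^ 3 := by
    refine max_le ?_ ?_
    · -- `log (2π) ≤ 1.84`
      have h2π : Real.log (2 * π) ≤ 1.84 := by
        rw [Real.log_le_iff_le_exp (by positivity)]
        have hπ : 2 * π ≤ 6.2832 := by have := pi_lt_d4; linarith
        refine hπ.trans ?_
        have h := Real.sum_le_exp_of_nonneg (x := 1.84) (by norm_num) 8
        refine le_trans ?_ h
        simp only [Finset.sum_range_succ, Finset.sum_range_zero, Nat.factorial]
        norm_num
      calc (g : ℝ) / 2 * Real.log (2 * π) ≤ (g : ℝ) / 2 * 1.84 := by gcongr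
        _ ≤ (g : ℝ) ^ 3 := by linarith
    · have hl : Real.log ((g : ℝ) / 2) ≤ (g : ℝ) / 2 - 1 := Real.log_le_sub_one_of_pos (by positivity)
      calc (g : ℝ) / 4 * Real.log (g / 2) - g / 4 ≤ (g : ℝ) / 4 * (g / 2 - 1) - g / 4 := by
            gcongr
        _ ≤ (g : ℝ) ^ 3 := by nlinarith
  linarith


/-! ### Thm. 2.4.1: the constants `90 g³`, `4g log(2π)`, `93 g³` (appended) -/

/-- `4 g log(2π) ≤ 7.36 g`. [folklore] -/
theorem four_mul_log_two_pi_le {g : ℝ} (hg : 0 ≤ g) : 4 * g * Real.log (2 * π) ≤ 7.36 * g := by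
  have h2π : Real.log (2 * π) ≤ 1.84 := by
    rw [Real.log_le_iff_le_exp (by positivity)]
    have hπ : 2 * π ≤ 6.2832 := by have := pi_lt_d4; linarith
    refine hπ.trans ?_
    have h := Real.sum_le_exp_of_nonneg (x := 1.84) (by norm_num) 8
    refine le_trans ?_ h
    simp only [Finset.sum_range_succ, Finset.sum_range_zero, Nat.factorial]
    norm_num
  nlinarith

/-- **Thm. 2.4.1, the lower bound for `δ_Fal` (`g ≥ 2`).** From the second row of Prop. 2.4.8,
`-g log(2π) ≤ (2g-1)(g+1)/(4(g-1)) e + δ/4 + 20g³`, and `e ≤ 4g(g-1) h(b)` (Faltings):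
`δ_Fal(X) ≥ -90g³ - 4g(2g-1)(g+1) h(b)`. [cite: Javanpeykar2014, Thm. 2.4.1 (proof)] -/
theorem thm241_delta_lower {g e δ h : ℝ} (hg : 2 ≤ g) (he : e ≤ 4 * g * (g - 1) * h)
    (hrow : -g * Real.log (2 * π) ≤
      (2 * g - 1) * (g + 1) / (4 * (g - 1)) * e + δ / 4 + 20 * g ^ 3) :
    -90 * g ^ 3 - 4 * g * (2 * g - 1) * (g + 1) * h ≤ δ := by
  have hg1 : 0 < g - 1 := by linarith
  have hcoef : 0 ≤ (2 * g - 1) * (g + 1) / (4 * (g - 1)) := by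
    apply div_nonneg <;> nlinarith
  have h1 : (2 * g - 1) * (g + 1) / (4 * (g - 1)) * e ≤
      (2 * g - 1) * (g + 1) / (4 * (g - 1)) * (4 * g * (g - 1) * h) :=
    mul_le_mul_of_nonneg_left he hcoef
  have h2 : (2 * g - 1) * (g + 1) / (4 * (g - 1)) * (4 * g * (g - 1) * h) =
      g * (2 * g - 1) * (g + 1) * h := by
    field_simp
  have hlog := four_mul_log_two_pi_le (by linarith : (0 : ℝ) ≤ g)
  have hg2 : 1 ≤ g ^ 2 := by nlinarith
  have hg3 : g ≤ g ^ 3 := by nlinarith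
  nlinarith

/-- **Thm. 2.4.1, the upper bound for `δ_Fal`.** From Noether's formula with `e(X), Δ(X) ≥ 0`,
`δ ≤ 12 h_Fal + 4g log(2π)`, and `h_Fal ≤ ½ g(g+1) h(b) + log‖Wr‖_Ar(b)`:
`δ_Fal(X) ≤ 6g(g+1) h(b) + 12 log‖Wr‖_Ar(b) + 4g log(2π)`.
[cite: Javanpeykar2014, Thm. 2.4.1 (proof)] -/
theorem thm241_delta_upper {g δ h hF L : ℝ} (hδ : δ ≤ 12 * hF + 4 * g * Real.log (2 * π))
    (hhF : hF ≤ 1 / 2 * g * (g + 1) * h + L) :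
    δ ≤ 6 * g * (g + 1) * h + 12 * L + 4 * g * Real.log (2 * π) := by
  linarith

/-- **Thm. 2.4.1, the upper bound for `Δ` (`g ≥ 2`).** From `Δ ≤ 12 h_Fal - δ + 4g log(2π)`,
`h_Fal ≤ ½ g(g+1) h(b) + log‖Wr‖_Ar(b)` and the lower bound for `δ`:
`Δ(X) ≤ 2g(g+1)(4g+1) h(b) + 12 log‖Wr‖_Ar(b) + 93 g³`.
[cite: Javanpeykar2014, Thm. 2.4.1 (proof)] -/
theorem thm241_Delta_upper {g Δ δ h hF L : ℝ} (hg : 2 ≤ g)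
    (hΔ : Δ ≤ 12 * hF - δ + 4 * g * Real.log (2 * π)) (hhF : hF ≤ 1 / 2 * g * (g + 1) * h + L)
    (hδ : -90 * g ^ 3 - 4 * g * (2 * g - 1) * (g + 1) * h ≤ δ) :
    Δ ≤ 2 * g * (g + 1) * (4 * g + 1) * h + 12 * L + 93 * g ^ 3 := by
  have hlog := four_mul_log_two_pi_le (by linarith : (0 : ℝ) ≤ g)
  have hg2 : 4 ≤ g ^ 2 := by nlinarith
  have hg3 : 7.36 * g ≤ 3 * g ^ 3 := by nlinarith
  nlinarith

end Javanpeykar2014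

end Literature.NumberTheory.DiophantineGeometry

end
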